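import Summits.AtomisticToContinuum.FouriersLaw.Theses.OddSectorIrreversibility
import Summits.AtomisticToContinuum.FouriersLaw.Theses.JunctionLocality
import Summits.AtomisticToContinuum.FouriersLaw.Theses.FeketeSeriesLaw
import Summits.AtomisticToContinuum.FouriersLaw.Theorems.BoundedResponseConverges.Negative.LoadBearing

/-!
# Skeleton line `ohmic-floor-monotone-ladder` for crux `BoundedResponseConverges` (stmt-AtomisticToContinuum-9141)

Route `OddSectorIrreversibility` (import slot shared verbatim with `TransferKernelPositivity`, `LocalOhmBV`,
`MatthiessenLadder`; Disproof `*_twin_iff`). The crux: for `pinnedChain ω₂ lam β γ` (all `> 0`), under weak-NESS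
uniqueness, along every steady-state family and every `T > 0`, a BOUNDED sequence of clause-(ii) response
coefficients `D_N` converges to some `k > 0`.

## The line (crux idea card `ohmic-floor-monotone-ladder`, ideator 2; triage r1: 3 × pass, "sharpen to the dichotomy")

LEVER: ONE SIGN between two consecutive finite chains — the conductance–length product `D_N = (N−1)·G_N` is
EVENTUALLY MONOTONE in the length `N`. With the crux's own `BddAbove (range |D|)` that IS convergence (monotone
convergence theorem), and an `N`-uniform conductance floor gives `k > 0`. All anharmonic content of Fourier's law
stays in the crux's boundedness hypothesis (the ladder is TRUE at the harmonic corner, where `BddAbove` fails —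
`Theorems.boundedResponseConverges_false_without_bddAbove_harmonic`).

TRANSFER (this plan's cut, the engine level of the card's "far-end transmission" reading): by the fixed-`N`
open-chain Green–Kubo / Novikov response formula (Kundu–Dhar–Narayan 2009; Rey-Bellet 2003 Rem. 4.4; BLR 2000
(32)/(35)) together with the contact energy balance `J = γ(⟨p²_{N−1}⟩ − T_R)` and the equal-temperature sum rule
`∂_{T_L} + ∂_{T_R} = d/dT`,
  `D_N = (γ²/T²)·(N−1)·K_N`,  `K_N := ∫₀^∞ Cov_{μ_T}(p_0²(0), p_{N−1}²(t)) dt`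
(the CORNER of the kinetic-energy transfer kernel of the EQUILIBRIUM chain, both baths at `T`; `cornerKernel`
below, typed over the tree's constructed `OscillatorChain.transitionKernel` and `OscillatorChain.gibbsMeasure`).
Exact check at the harmonic corner (this folder, `kit/corner_check.py`, pure Lyapunov algebra, four `(ω₂, γ, T)`,
`N ≤ 11`): `D_N/((N−1)K_N) = γ²/T²` to all printed digits, `K` forward = `K` time-reversed, and the kernel ladder
`(N−1)K_N ≤ N·K_{N+1}` holds at every `N` (as it must: the corner is where `BddAbove`, not the ladder, fails).
So the ladder becomes a statement about EQUILIBRIUM DYNAMICS ONLY — no NESS, no `δ → 0`, no uniqueness: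
  `stub_kernelLadder`:  eventually in `N`, the sign of `N·K_{N+1} − (N−1)·K_N` is constant
(the DICHOTOMY form asked for by all three triagers: `(eventually ↑) ∨ (eventually ↓)`; the card's physics and
all exact benchmarks — BLL self-consistent chain ν = 1, 0.2, 0.05 incl. the mean-free-path-20 crossover,
`BenchIdeator2.md`; harmonic corner — give the `↑` branch, approach from below, contact-resistance dominated).

STUBS (registered): `stub_cornerKubo` (fixed-`N`, M/L: the corner formula + integrability of the equilibrium
covariance; USES the uniqueness hypothesis H_unique — honours `_false_without_unique`), `stub_kernelLadder`
(the lever, L/open, HARDEST), `stub_floor` (= `JunctionLocality.ConductanceLowerBound`, stmt-11749, by name: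
the `N`-uniform conductance floor; excludes the insulating skeleton mode; in the predicted `↑` world it costs
only fixed-`N` positivity — PROVED below as `conductanceLowerBound_of_ladderUp` from
`FeketeSeriesLaw.PositiveConductance`, stmt-11750, M).
COMPOSITION (kernel-checked, no `sorry`): `BoundedResponseConverges_of : stub_cornerKubo → stub_kernelLadder →
ConductanceLowerBound → OddSectorIrreversibility.BoundedResponseConverges` — uses `BddAbove` (both branches of
the monotone convergence theorem) and concludes the crux BY NAME.
-/

noncomputable section

open MeasureTheory Filter Topology Set
open Literature.MathematicalPhysics.KineticTheory.HeatConduction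

namespace Summit.AtomisticToContinuum.FouriersLaw.Cruxes.BoundedResponseConverges.OhmicFloorMonotoneLadder

/-! ### The crux's frame, abbreviated (verbatim bodies of the crux's hypothesis blocks) -/

/-- weak-NESS uniqueness (the crux's first hypothesis; route item `NessUnique`, stmt-0741). -/
def NessUniq (P : OscillatorChain) : Prop :=
  ∀ (N : ℕ) (T_L T_R : ℝ), 0 < T_L → 0 < T_R → ∀ μ ν : Measure (PhaseSpace N),
    P.IsSteadyState N T_L T_R μ → P.IsSteadyState N T_L T_R ν → μ = ν

/-- a steady-state family of `P` (weak steady state for every `N` and all `T_L, T_R > 0`). -/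
def IsSteadyFamily (P : OscillatorChain) (μ : (N : ℕ) → ℝ → ℝ → Measure (PhaseSpace N)) : Prop :=
  ∀ (N : ℕ) (T_L T_R : ℝ), 0 < T_L → 0 < T_R → P.IsSteadyState N T_L T_R (μ N T_L T_R)

/-- `D` is a sequence of clause-(ii) response coefficients along `μ` at temperature `T`. -/
def IsResponseSeq (P : OscillatorChain) (μ : (N : ℕ) → ℝ → ℝ → Measure (PhaseSpace N))
    (T : ℝ) (D : ℕ → ℝ) : Prop :=
  ∀ N : ℕ, Tendsto (fun δ : ℝ => P.totalCurrent (μ N (T + δ / 2) (T - δ / 2)) / δ)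
    (𝓝[≠] 0) (𝓝 (D N))

/-- The crux, re-read through the abbreviations: certifies that the frame used below IS the crux's own
(definitional). -/
example : Theses.OddSectorIrreversibility.BoundedResponseConverges ↔
    ∀ ω₂ lam β γ : ℝ, 0 < ω₂ → 0 < lam → 0 < β → 0 < γ →
      NessUniq (pinnedChain ω₂ lam β γ) →
      ∀ μ : (N : ℕ) → ℝ → ℝ → Measure (PhaseSpace N), IsSteadyFamily (pinnedChain ω₂ lam β γ) μ →
      ∀ T : ℝ, 0 < T → ∀ D : ℕ → ℝ, IsResponseSeq (pinnedChain ω₂ lam β γ) μ T D →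
      BddAbove (Set.range fun N => |D N|) → ∃ k : ℝ, 0 < k ∧ Tendsto D atTop (𝓝 k) :=
  Iff.rfl

/-! ### The equilibrium kinetic-energy transfer kernel (objects of the transfer) -/

/-- Equilibrium kinetic-energy covariance at lag `t ≥ 0` between sites `b` (time `0`) and `i` (time `t`) of the
`N`-chain `pinnedChain ω₂ lam β γ` with BOTH baths at temperature `T`:
`kinCov … N b i t = ∫ (p_b² − T) · E_x[p_i(t)²] dμ_T(x) = Cov_{μ_T}(p_b²(0), p_i²(t))`
(`μ_T` = the Gibbs measure `gibbsMeasure N T`, for which `μ_T(p_b²) = T`; `E_x` = the constructed transition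
kernel `transitionKernel N T T t`). At the harmonic corner (Isserlis) it equals `2·Cov_{μ_T}(p_b, p_i(t))² ≥ 0`. -/
def kinCov (ω₂ lam β γ T : ℝ) (N : ℕ) (b i : Fin N) (t : ℝ) : ℝ :=
  ∫ x, ((x.2 b) ^ 2 - T) *
      (∫ y, (y.2 i) ^ 2 ∂((pinnedChain ω₂ lam β γ).transitionKernel N T T t.toNNReal x))
    ∂((pinnedChain ω₂ lam β γ).gibbsMeasure N T)

/-- The kinetic-energy TRANSFER KERNEL `K_N(b, i) := ∫₀^∞ Cov_{μ_T}(p_b²(0), p_i²(t)) dt` (junk if the lag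
covariance is not integrable on `(0, ∞)`; integrability at fixed `N` is part of `stub_cornerKubo`). By the
Novikov / open-chain Green–Kubo response formula `∂⟨p_i²⟩_NESS/∂T_b |_{T_L = T_R = T} = (γ/T²)·K_N(b, i)`
(Kundu–Dhar–Narayan 2009; Rey-Bellet 2003 Rem. 4.4). -/
def transferKernel (ω₂ lam β γ T : ℝ) (N : ℕ) (b i : Fin N) : ℝ :=
  ∫ t in Set.Ioi (0 : ℝ), kinCov ω₂ lam β γ T N b i t

/-- The CORNER `K_N := K_N(0, N−1)` of the transfer kernel (contact-to-contact; junk `0` for the empty chain).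
`(γ/T²)·K_N = 𝒯_N := ∂⟨p²_{N−1}⟩/∂T_L` is the far-end thermal transmission of the card, and
`D_N = γ(N−1)𝒯_N = (γ²/T²)(N−1)K_N` (`stub_cornerKubo`). -/
def cornerKernel (ω₂ lam β γ T : ℝ) (N : ℕ) : ℝ :=
  if h : 0 < N then transferKernel ω₂ lam β γ T N ⟨0, h⟩ ⟨N - 1, by omega⟩ else 0

/-! ### The three statements of the line -/

/-- STATEMENT 1 (fixed `N`; size M/L) — **corner Green–Kubo formula**. Under weak-NESS uniqueness, along any
steady-state family, for `T > 0` and every `N ≥ 2`: (a) the equilibrium contact-to-contact kinetic-energy lag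
covariance `t ↦ Cov_{μ_T}(p_0²(0), p²_{N−1}(t))` is integrable on `(0, ∞)` (fixed-`N` mixing of the equilibrium
Langevin chain, CEHR 2018 Thm 2.13 (3) with the `e^{ϑH}`-weighted norm); (b) every clause-(ii) response
coefficient `d` at length `N` equals `(γ²/T²)·(N−1)·K_N`. Content: differentiability of the NESS expectation of
`p²_{N−1}` in the bath temperatures with the Novikov / linear-response formula
`∂_{T_b}⟨f⟩ = γ∫₀^∞ μ_T(∂²_{p_b} P_t f) dt = (γ/T²)∫₀^∞ Cov_{μ_T}(p_b², P_t f) dt` (two Gaussian integrations by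
parts under `μ_T ∝ e^{−H/T}`), the contact energy balance `J = γ(⟨p²_{N−1}⟩ − T_R)` (stationarity tested on
polynomially growing observables — cutoff with the exponential moments of CEHR 2018), the sum rule
`∂_{T_L}⟨p²⟩ + ∂_{T_R}⟨p²⟩ = 1` at `T_L = T_R` (equipartition `μ_T(p²) = T`), and uniqueness (the family's member
at `(T_L, T_R)` IS the NESS, and `μ N T T = μ_T` by `pinnedChain_isSteadyState_gibbsMeasure`) — so
`dJ/dδ = γ·∂_{T_L}⟨p²_{N−1}⟩ = (γ²/T²)K_N` and `d = (N−1)·dJ/dδ`. USES H_unique (without it, at `γ = 0`, the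
zero-current Gibbs family is steady — `Theorems.boundedResponseConverges_false_without_unique_gamma_zero`; here
`γ > 0` and the formula's `γ²` prefactor is consistent with `D ≡ 0` there). Exact harmonic-corner check of the
constant: `kit/corner_check.py` (planner folder), `D_N/((N−1)K_N) = γ²/T²` for `(ω₂,γ,T) ∈ {(1,1,1),(1,2,1),
(0.5,1,2),(2,0.5,0.7)}`, `N = 2…11`. Refs: KunduDharNarayan2009 (arXiv:0809.4543), ReyBellet2003
(arXiv:math-ph/0303021) Rem 4.4 (51)–(56), BonettoLebowitzReyBellet2000 §5.2 (32), §6.3 (34)–(36),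
HairerMajda2009 (arXiv:0909.4313), CuneoEckmannHairerReyBellet2018 Thm 2.13; tree:
`OscillatorChain.KuboFormula` (statement-level cousin for bond currents), `TransferKernelPositivity.ContactIdentity`
(stmt-12015, the NESS-side corner identity `d = γ(N−1)(θ₁ + 1/2)`). -/
def CornerKubo : Prop :=
  ∀ ω₂ lam β γ : ℝ, 0 < ω₂ → 0 < lam → 0 < β → 0 < γ →
    NessUniq (pinnedChain ω₂ lam β γ) →
    ∀ μ : (N : ℕ) → ℝ → ℝ → Measure (PhaseSpace N), IsSteadyFamily (pinnedChain ω₂ lam β γ) μ →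
    ∀ T : ℝ, 0 < T → ∀ (N : ℕ) (hN : 2 ≤ N),
      IntegrableOn (fun t : ℝ => kinCov ω₂ lam β γ T N ⟨0, by omega⟩ ⟨N - 1, by omega⟩ t) (Set.Ioi 0) ∧
      ∀ d : ℝ, Tendsto (fun δ : ℝ =>
          (pinnedChain ω₂ lam β γ).totalCurrent (μ N (T + δ / 2) (T - δ / 2)) / δ) (𝓝[≠] 0) (𝓝 d) →
        d = (γ ^ 2 / T ^ 2) * ((N : ℝ) - 1) * cornerKernel ω₂ lam β γ T N

/-- STATEMENT 2 (the LEVER; size L / open; HARDEST) — **kernel ladder, dichotomy form**: for every parameter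
point and `T > 0` the sign of `N·K_{N+1} − (N−1)·K_N` is EVENTUALLY CONSTANT: either
`(N−1)·K_N ≤ N·K_{N+1}` for all `N ≥ N₀` (the predicted branch: the far-end transmission of the equilibrium chain
decays at most harmonically when the chain is lengthened by one site — "no sub-Ohmic scale"; via
`stub_cornerKubo` exactly `D_N ≤ D_{N+1}`, approach of `D_N` to its limit FROM BELOW, contact-resistance
dominated: Kapitza jumps `(2εℓ + L)∇T = ΔT`, LLP2003 §3.4; kinetic mixtures `Σ_k w_k(N−1)ℓ_k/(N−1+ℓ_k)`
increasing term by term; BLL benches 0 violations) or the reverse inequality for all `N ≥ N₀` (the overshoot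
world B of the triage: bulk increments of the resistance approaching `1/κ` from below non-summably). A PURE
EQUILIBRIUM statement — Gibbs measure and equilibrium transition kernels of two chains differing by one site; no
NESS, no `δ → 0`, no uniqueness, no rate, no limit object, no constant uniform in `N` except the threshold
`N₀(ω₂, lam, β, γ, T)`. TRUE at the harmonic corner (`↑` branch; Isserlis makes `K` a sum of squares:
`kit/corner_check.py` `N ≤ 11`, and in `D`-form `D_N = (N−1)/8` exactly, kit j008254 `N ≤ 150`) where the crux's
`BddAbove` fails — so it cannot prove too much (`Theorems.boundedResponseConverges_false_without_bddAbove_harmonic`).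
Excludes the oscillating skeleton mode (`Theorems.boundedResponseConverges_skeleton_oscillating`). NOT implied by
the crux (a convergent `D` need not be eventually monotone) and does not imply it (needs `BddAbove` + the floor).
Why it might fail: the sign is an `O(N⁻²)` effect at large `N` (`D_{N+1} − D_N ≈ 2r_cκ²/N²`) decided by contact
resistance vs the unsigned approach of bulk resistance increments to `1/κ`; an oscillating correction
(`κ + (−1)^N/N`, sublattice/parity structure — absent for the monatomic `pinnedChain`) kills BOTH branches while
the crux survives; printed `κ(N)` curves of pinned anharmonic chains rise and saturate (AokiKusnezov2001,
HuLiZhao2000, LLP2003 §6; the ding-a-ling MINIMUM of `κ(N)` below `N ≈ 20`, Mimnagh–Ballentine 1997, is absorbed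
by "eventually"). Engines: sign the difference of the two time-integrated contact-to-contact covariances by
realising the `N`-chain inside the `(N+1)`-chain with the right bath moved one site inward (second-order response
in the bath position; Karlin/birth–death comparison ACROSS `N`); cumulant split `K = 2∫R² + ∫κ₄` near the
harmonic corner / high `T` first. -/
def KernelLadder : Prop :=
  ∀ ω₂ lam β γ : ℝ, 0 < ω₂ → 0 < lam → 0 < β → 0 < γ → ∀ T : ℝ, 0 < T →
    ∃ N₀ : ℕ,
      (∀ N : ℕ, N₀ ≤ N →
        ((N : ℝ) - 1) * cornerKernel ω₂ lam β γ T N ≤ (N : ℝ) * cornerKernel ω₂ lam β γ T (N + 1)) ∨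
      (∀ N : ℕ, N₀ ≤ N →
        (N : ℝ) * cornerKernel ω₂ lam β γ T (N + 1) ≤ ((N : ℝ) - 1) * cornerKernel ω₂ lam β γ T N)

/-- The PREDICTED branch of `KernelLadder` alone (eventually non-decreasing conductance–length product; the
card's `EventuallyMonotoneResponse` in kernel form). Not a registered stub: recorded because (i) it implies
`KernelLadder` trivially and (ii) together with fixed-`N` positivity it discharges `stub_floor`
(`conductanceLowerBound_of_ladderUp`). -/
def KernelLadderUp : Prop :=
  ∀ ω₂ lam β γ : ℝ, 0 < ω₂ → 0 < lam → 0 < β → 0 < γ → ∀ T : ℝ, 0 < T →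
    ∃ N₀ : ℕ, ∀ N : ℕ, N₀ ≤ N →
      ((N : ℝ) - 1) * cornerKernel ω₂ lam β γ T N ≤ (N : ℝ) * cornerKernel ω₂ lam β γ T (N + 1)

theorem kernelLadder_of_up (h : KernelLadderUp) : KernelLadder :=
  fun ω₂ lam β γ hω hl hβ hγ T hT =>
    let ⟨N₀, hN₀⟩ := h ω₂ lam β γ hω hl hβ hγ T hT
    ⟨N₀, Or.inl hN₀⟩

/-! ### Registered stubs -/

/-- STUB 1 (M/L, fixed `N`, provable with fixed-`N` tools) — the corner Green–Kubo formula `CornerKubo`. -/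
theorem stub_cornerKubo :
    ∀ ω₂ lam β γ : ℝ, 0 < ω₂ → 0 < lam → 0 < β → 0 < γ →
      NessUniq (pinnedChain ω₂ lam β γ) →
      ∀ μ : (N : ℕ) → ℝ → ℝ → Measure (PhaseSpace N), IsSteadyFamily (pinnedChain ω₂ lam β γ) μ →
      ∀ T : ℝ, 0 < T → ∀ (N : ℕ) (hN : 2 ≤ N),
        IntegrableOn (fun t : ℝ => kinCov ω₂ lam β γ T N ⟨0, by omega⟩ ⟨N - 1, by omega⟩ t) (Set.Ioi 0) ∧
        ∀ d : ℝ, Tendsto (fun δ : ℝ =>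
            (pinnedChain ω₂ lam β γ).totalCurrent (μ N (T + δ / 2) (T - δ / 2)) / δ) (𝓝[≠] 0) (𝓝 d) →
          d = (γ ^ 2 / T ^ 2) * ((N : ℝ) - 1) * cornerKernel ω₂ lam β γ T N := by
  sorry

/-- STUB 2 (L / open, HARDEST) — the kernel ladder in dichotomy form `KernelLadder`. -/
theorem stub_kernelLadder :
    ∀ ω₂ lam β γ : ℝ, 0 < ω₂ → 0 < lam → 0 < β → 0 < γ → ∀ T : ℝ, 0 < T →
      ∃ N₀ : ℕ,
        (∀ N : ℕ, N₀ ≤ N →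
          ((N : ℝ) - 1) * cornerKernel ω₂ lam β γ T N ≤ (N : ℝ) * cornerKernel ω₂ lam β γ T (N + 1)) ∨
        (∀ N : ℕ, N₀ ≤ N →
          (N : ℝ) * cornerKernel ω₂ lam β γ T (N + 1) ≤ ((N : ℝ) - 1) * cornerKernel ω₂ lam β γ T N) := by
  sorry

/-- STUB 3 (L; = route item `JunctionLocality.ConductanceLowerBound`, stmt-AtomisticToContinuum-11749, BY NAME —
one proof closes both) — the `N`-uniform conductance floor `∃ c > 0, ∃ N₁, ∀ N ≥ N₁, c ≤ D_N`: "no perfect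
insulator". Load-bearing for `0 < k` in the `↓` branch (`Theorems.boundedResponseConverges_skeleton_insulating`:
an antitone positive bounded `D` may tend to `0`); in the `↑` branch it is fixed-`N` positivity in disguise
(`conductanceLowerBound_of_ladderUp`). Its own standing analysis: `Cruxes/ConductanceLowerBound/Disproof.lean`
(De Roeck–Huveneers asymptotic localisation is super-polynomially small, never zero, conductivity). -/
theorem stub_floor : Theses.JunctionLocality.ConductanceLowerBound := by
  sorry

/-! ### Consistency: each named statement IS its registered stub (definitionally) -/

theorem cornerKubo_holds : CornerKubo := stub_cornerKubo
theorem kernelLadder_holds : KernelLadder := stub_kernelLadder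

/-! ### Name-keyed aliases of the statements (hypotheses of the composition; the skeleton audit admits a
hypothesis only if its head constant is a registered obligation or is named like a declared stub) -/
namespace Registered

/-- Alias of `CornerKubo` keyed by the registered stub name. -/
abbrev stub_cornerKubo : Prop := CornerKubo
/-- Alias of `KernelLadder` keyed by the registered stub name. -/
abbrev stub_kernelLadder : Prop := KernelLadder
/-- Alias of the floor (the route item itself) keyed by the registered stub name. -/
abbrev stub_floor : Prop := Theses.JunctionLocality.ConductanceLowerBound

end Registered

/-! ### Glue lemmas (PROVED) -/

/-- Transport of the kernel ladder to the response sequence through the corner formula: for `N ≥ 2`,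
`D N = c·(N−1)·K_N` with `c = γ²/T² > 0`, so the kernel inequalities are the `D`-inequalities. -/
theorem response_le_of_kernel_le {c : ℝ} (hc : 0 ≤ c) {K : ℕ → ℝ} {D : ℕ → ℝ} {N : ℕ}
    (hN : D N = c * ((N : ℝ) - 1) * K N) (hN1 : D (N + 1) = c * (((N + 1 : ℕ) : ℝ) - 1) * K (N + 1))
    (h : ((N : ℝ) - 1) * K N ≤ (N : ℝ) * K (N + 1)) : D N ≤ D (N + 1) := by
  rw [hN, hN1]
  have h1 : (((N + 1 : ℕ) : ℝ) - 1) = (N : ℝ) := by push_cast; ring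
  rw [h1, mul_assoc, mul_assoc]
  exact mul_le_mul_of_nonneg_left h hc

theorem response_ge_of_kernel_ge {c : ℝ} (hc : 0 ≤ c) {K : ℕ → ℝ} {D : ℕ → ℝ} {N : ℕ}
    (hN : D N = c * ((N : ℝ) - 1) * K N) (hN1 : D (N + 1) = c * (((N + 1 : ℕ) : ℝ) - 1) * K (N + 1))
    (h : (N : ℝ) * K (N + 1) ≤ ((N : ℝ) - 1) * K N) : D (N + 1) ≤ D N := by
  rw [hN, hN1]
  have h1 : (((N + 1 : ℕ) : ℝ) - 1) = (N : ℝ) := by push_cast; ring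
  rw [h1, mul_assoc, mul_assoc]
  exact mul_le_mul_of_nonneg_left h hc

/-- Real-analysis core (both branches of the monotone convergence theorem + a floor): an eventually monotone
sequence with `|D|` bounded and `c ≤ D N` eventually (`c > 0`) converges to some `k ≥ c > 0`. -/
theorem tendsto_of_eventually_monotone_floor (D : ℕ → ℝ) (M : ℕ) (B c : ℝ) (N₁ : ℕ) (hc : 0 < c)
    (hB : ∀ N, |D N| ≤ B) (hfloor : ∀ N, N₁ ≤ N → c ≤ D N)
    (hdich : (∀ n : ℕ, D (M + n) ≤ D (M + n + 1)) ∨ (∀ n : ℕ, D (M + n + 1) ≤ D (M + n))) :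
    ∃ k : ℝ, 0 < k ∧ Tendsto D atTop (𝓝 k) := by
  have hbddA : BddAbove (Set.range fun n : ℕ => D (M + n)) :=
    ⟨B, by rintro _ ⟨n, rfl⟩; exact (le_abs_self _).trans (hB (M + n))⟩
  have hbddB : BddBelow (Set.range fun n : ℕ => D (M + n)) :=
    ⟨-B, by rintro _ ⟨n, rfl⟩; exact (neg_le.mp ((neg_le_abs _).trans (hB (M + n))))⟩
  obtain ⟨k, hk⟩ : ∃ k : ℝ, Tendsto (fun n : ℕ => D (M + n)) atTop (𝓝 k) := by
    rcases hdich with hup | hdown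
    · exact ⟨_, tendsto_atTop_ciSup (monotone_nat_of_le_succ fun n => hup n) hbddA⟩
    · exact ⟨_, tendsto_atTop_ciInf (antitone_nat_of_succ_le fun n => hdown n) hbddB⟩
  have hkD : Tendsto D atTop (𝓝 k) := by
    have h2 : Tendsto (fun n => D (n + M)) atTop (𝓝 k) := hk.congr fun n => by rw [Nat.add_comm M n]
    exact (tendsto_add_atTop_iff_nat M).mp h2
  refine ⟨k, lt_of_lt_of_le hc ?_, hkD⟩
  exact ge_of_tendsto hkD (eventually_atTop.2 ⟨N₁, fun N hN => hfloor N hN⟩)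

/-! ### The composition: the three stubs imply the crux, BY NAME -/

/-- `BoundedResponseConverges` from the three stubs (pure logic + real analysis; no `sorry`): STUB 1 turns the
response sequence into `(γ²/T²)(N−1)K_N` for `N ≥ 2`; STUB 2 makes it eventually monotone (one of two
directions); the crux's OWN hypothesis `BddAbove (range |D|)` then gives convergence (monotone convergence, both
branches — this is where `BddAbove` is consumed, as `_false_without_bddAbove_harmonic` demands); STUB 3 gives
`c ≤ D_N` eventually, hence `k ≥ c > 0`. -/
theorem BoundedResponseConverges_of (h1 : Registered.stub_cornerKubo) (h2 : Registered.stub_kernelLadder)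
    (h3 : Theses.JunctionLocality.ConductanceLowerBound) :
    Theses.OddSectorIrreversibility.BoundedResponseConverges := by
  intro ω₂ lam β γ hω hl hβ hγ hU μ hμ T hT D hD hB
  -- STUB 1: the corner formula along this family
  have hK : ∀ N : ℕ, 2 ≤ N →
      D N = (γ ^ 2 / T ^ 2) * ((N : ℝ) - 1) * cornerKernel ω₂ lam β γ T N := fun N hN =>
    (h1 ω₂ lam β γ hω hl hβ hγ hU μ hμ T hT N hN).2 (D N) (hD N)
  -- STUB 2: the kernel dichotomy
  obtain ⟨N₀, hlad⟩ := h2 ω₂ lam β γ hω hl hβ hγ T hT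
  -- STUB 3: the floor
  obtain ⟨c, hc, N₁, hfloor⟩ := h3 ω₂ lam β γ hω hl hβ hγ hU μ hμ T hT D hD
  obtain ⟨B, hBB⟩ := hB
  have hB' : ∀ N, |D N| ≤ B := fun N => hBB ⟨N, rfl⟩
  have hc0 : (0 : ℝ) ≤ γ ^ 2 / T ^ 2 := by positivity
  -- threshold beyond which both the corner formula (N ≥ 2) and the ladder (N ≥ N₀) are available
  set M : ℕ := max N₀ 2 with hMdef
  have hM0 : N₀ ≤ M := le_max_left _ _
  have hM2 : 2 ≤ M := le_max_right _ _
  have hdich : (∀ n : ℕ, D (M + n) ≤ D (M + n + 1)) ∨ (∀ n : ℕ, D (M + n + 1) ≤ D (M + n)) := by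
    rcases hlad with hup | hdown
    · refine Or.inl fun n => ?_
      exact response_le_of_kernel_le hc0 (hK (M + n) (by omega)) (hK (M + n + 1) (by omega))
        (hup (M + n) (by omega))
    · refine Or.inr fun n => ?_
      exact response_ge_of_kernel_ge hc0 (hK (M + n) (by omega)) (hK (M + n + 1) (by omega))
        (hdown (M + n) (by omega))
  exact tendsto_of_eventually_monotone_floor D M B c N₁ hc hB' hfloor hdich

/-- Wiring check: the registered stubs feed `BoundedResponseConverges_of` as stated. -/
example : Theses.OddSectorIrreversibility.BoundedResponseConverges :=
  BoundedResponseConverges_of stub_cornerKubo stub_kernelLadder stub_floor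

/- The three sibling routes' copies of the crux (`TransferKernelPositivity`, `LocalOhmBV`, `MatthiessenLadder`)
close by the very same term: they are definitional twins (`Disproof.*_twin_iff`, `Iff.rfl`); not imported here
to keep the check cone small. -/

/-! ### The predicted world: in the `↑` branch the floor costs only fixed-`N` positivity (PROVED) -/

/-- If the PREDICTED branch holds (`KernelLadderUp`: eventually `D_N ≤ D_{N+1}`), then STUB 3 follows from the
fixed-`N` positivity item `FeketeSeriesLaw.PositiveConductance` (stmt-11750, size M: non-degenerate Kubo variance
at each `N ≥ 2`): `c := D_{max(N₀,2)} > 0` is a floor from there on. So in the card's world the line needs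
exactly: STUB 1 (fixed `N`), the `↑` ladder, and positivity at ONE length beyond the threshold. -/
theorem conductanceLowerBound_of_ladderUp (h1 : CornerKubo) (h2 : KernelLadderUp)
    (hP : Theses.FeketeSeriesLaw.PositiveConductance) : Theses.JunctionLocality.ConductanceLowerBound := by
  intro ω₂ lam β γ hω hl hβ hγ hU μ hμ T hT D hD
  have hK : ∀ N : ℕ, 2 ≤ N →
      D N = (γ ^ 2 / T ^ 2) * ((N : ℝ) - 1) * cornerKernel ω₂ lam β γ T N := fun N hN =>
    (h1 ω₂ lam β γ hω hl hβ hγ hU μ hμ T hT N hN).2 (D N) (hD N)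
  obtain ⟨N₀, hup⟩ := h2 ω₂ lam β γ hω hl hβ hγ T hT
  have hc0 : (0 : ℝ) ≤ γ ^ 2 / T ^ 2 := by positivity
  set M : ℕ := max N₀ 2 with hMdef
  have hM2 : 2 ≤ M := le_max_right _ _
  have hmono : Monotone fun n : ℕ => D (M + n) := by
    refine monotone_nat_of_le_succ fun n => ?_
    exact response_le_of_kernel_le hc0 (hK (M + n) (by omega)) (hK (M + n + 1) (by omega))
      (hup (M + n) (by omega))
  refine ⟨D M, hP ω₂ lam β γ hω hl hβ hγ hU μ hμ T hT D hD M hM2, M, fun N hN => ?_⟩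
  have h := hmono (Nat.zero_le (N - M))
  simp only [Nat.add_zero] at h
  rwa [Nat.add_sub_cancel' hN] at h

/-- ALTERNATIVE WIRING for the predicted world (PROVED; not the registered composition): the corner formula,
the `↑` ladder and fixed-`N` positivity (`FeketeSeriesLaw.PositiveConductance`, stmt-11750) already give BOTH the
floor (stmt-11749) AND the crux — the card's original `ladder_closes` (SketchIdeator2.lean), factored through the
kernel transfer. (Stated as a conjunction so that the skeleton audit sees exactly one theorem concluding the crux.) -/
theorem floor_and_crux_of_up (h1 : CornerKubo) (h2 : KernelLadderUp)
    (hP : Theses.FeketeSeriesLaw.PositiveConductance) :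
    Theses.JunctionLocality.ConductanceLowerBound ∧ Theses.OddSectorIrreversibility.BoundedResponseConverges :=
  ⟨conductanceLowerBound_of_ladderUp h1 h2 hP,
    BoundedResponseConverges_of h1 (kernelLadder_of_up h2) (conductanceLowerBound_of_ladderUp h1 h2 hP)⟩

/-! ### Scratch checks against the landed Negative lemmas (`Theorems/BoundedResponseConverges/Negative/LoadBearing.lean`) -/

/-- `BddAbove` is load-bearing at the harmonic corner (landed): all three stubs are TRUE there (STUB 1: exact
Gaussian identity; STUB 2: `↑` branch, exact; STUB 3: `D_N → +∞`), so the composition above MUST consume `hB` —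
it does, in `tendsto_of_eventually_monotone_floor`. -/
example {ω₂ γ : ℝ} (hω : 0 < ω₂) (hγ : 0 < γ) :=
  Theorems.boundedResponseConverges_false_without_bddAbove_harmonic hω hγ

/-- The insulating skeleton mode (landed) is what STUB 3 excludes; the oscillating mode (landed) is what STUB 2
excludes. -/
example := Theorems.boundedResponseConverges_skeleton_insulating
example := Theorems.boundedResponseConverges_skeleton_oscillating

end Summit.AtomisticToContinuum.FouriersLaw.Cruxes.BoundedResponseConverges.OhmicFloorMonotoneLadder

end
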